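import Summits.BirchSwinnertonDyer.BirchSwinnertonDyer.Theorems.GenusKolyvaginAtTwoGenusPrimitiveSupplyAtTwoTwistLocalConditionSigned
import Literature.NumberTheory.EllipticCurves.TwoTorsionGaloisActionProofs
import HarnessLib

/-!
# Route `GenusKolyvaginAtTwo`, crux #2 `GenusPrimitiveSupplyAtTwo` (stmt-BirchSwinnertonDyer-22136):
# the CANONICAL identification `E^{(d)}[2] ≅ E[2]` carries a FRAME DATUM — the `2`-torsion abscissae of a twist model and of `E`
# are affinely related over `K` along the untwisting (`x' = (u₀²u²/d)·x + b`)

Width seat `bsd-line-gk2-p4` g12 (cell `bsd-f1-sign2`), companion of gk2-p5's `…TwistLocalConditionSigned` (p619414 lineage) and of the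
KramerParity series part 9 (`GenusKolyKramer.isSquare_card_selmerGroup_mul_of_frame`, the `huniq`-free Kramer congruence for FRAMED
identifications). THEOREMS ONLY (no definition, no named fact, no `sorry`); helper `--supports stmt-BirchSwinnertonDyer-22136`; no item is
closed; BSD is not proved by any of this.

WHY. The cell's T-A / T-C rows by name (`F1Sign2.AdmissibleTwistSelmerShiftAtTwo`, hypothesis `NoRationalTwoTorsion` only) need Kramer's
congruence for the CANONICAL identification `ψ : Wd[2] ≃+ W[2]` of gk2-p5's series (the untwisting over `K̄` restricted to `2`-torsion,
`exists_addEquiv_geomTorsion_two_localSquare_signed`: the identification for which Lemma 2.10 (i) at split places and the transversality at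
the real place are PROVED), at image-`C₃` curves where the typed `MazurRubin2010.kramerParity` (binder `huniq`) is silent. Part 9 gives the
congruence for every identification carrying a FRAME DATUM (`ψ(T'_j) = T_{πj}`, `x'_i − x'_j = A·(x_{πi} − x_{πj})`, `A ∈ K`). This file
proves that the canonical `ψ` carries one:

* §1 `xco_twistPointsIso`, `xco_twistPointsIso_symm`, `xco_geomPointsCongr`, `xco_untwistEquiv` — the abscissa along each link of the
  untwisting chain (`x ↦ u⁻²(x − r)`, `x ↦ u²x + r`, `x ↦ x`, `x ↦ x/d`); `exists_xco_untwistChain` — along the whole chain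
  `Wd(K̄) → W^{(d)}(K̄) = V^{(d)}(K̄) → V(K̄) → W(K̄)`: `x(e P) = A·x(P) + B` with `A, B ∈ K`, `A ≠ 0`, for every affine `P`;
* §2 **`exists_addEquiv_geomTorsion_two_localSquare_signed_frame`** — gk2-p5's `exists_addEquiv_geomTorsion_two_localSquare_signed`
  VERBATIM (same `ψ`, same local untwistings `θ_E` with the sign dichotomy and the intertwining on torsion) PLUS the frame datum of `ψ`:
  `∃ π A, (∀ j, ψ T'_j = T_{πj}) ∧ (∀ i j, x'_i − x'_j = A·(x_{πi} − x_{πj}))`.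

References: [SilvermanAEC2009] III.1 (Table 3.1), X.2 Prop. 2.4, X.5 Cor. 5.4; [MazurRubin2010] Remark 2.4; [KlagsbrunMazurRubin2013] Lemma 5.2.
-/

set_option linter.dupNamespace false -- tree convention: `Summit.BirchSwinnertonDyer.BirchSwinnertonDyer.Theorems` (summit = sub-problem)
set_option autoImplicit false

noncomputable section

open scoped Classical

namespace Summit.BirchSwinnertonDyer.BirchSwinnertonDyer.Theorems.GenusKolyTwistLocal

open WeierstrassCurve Field
open Literature.NumberTheory.EllipticCurves
open Literature.NumberTheory.EllipticCurves.DokchitserDokchitser2012 (xco T xT eq_zero_or_eq_T coe_T_ne_zero T_injective)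

universe u

/-! ## §1 The abscissa along the untwisting chain -/

section Abscissa

variable {K : Type u} [Field K]

/-- Abscissa under the change of variables `C • W₁ = W₂` on geometric points: `x(C P) = u⁻²(x(P) − r)` for `P ≠ O`.
[cite: SilvermanAEC2009, III.1 Table 3.1] -/
theorem xco_twistPointsIso {W₁ W₂ : WeierstrassCurve K} {C : VariableChange K} (hC : C • W₁ = W₂)
    (P : geomPoints W₁) (hP : P ≠ 0) :
    xco W₂ (twistPointsIso hC P)
      = algebraMap K (AlgebraicClosure K) (((C.u⁻¹ : Kˣ) : K) ^ 2) * (xco W₁ P - algebraMap K (AlgebraicClosure K) C.r) := by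
  change (W₁.baseChange (AlgebraicClosure K)).toAffine.Point at P
  rcases P with _ | ⟨x, y, h⟩
  · exact absurd rfl hP
  · obtain ⟨h', e⟩ := twistPointsIso_some hC h
    change xco W₂ (twistPointsIso hC (show geomPoints W₁ from .some x y h)) = _
    rw [e]
    change (C.map (algebraMap K (AlgebraicClosure K))).toX x = _
    rw [VariableChange.toX_def]
    simp only [VariableChange.map, map_pow, Units.val_inv_eq_inv_val, map_inv₀]
    rfl

/-- `twistPointsIso` preserves non-vanishing. [folklore] -/
theorem twistPointsIso_ne_zero {W₁ W₂ : WeierstrassCurve K} {C : VariableChange K} (hC : C • W₁ = W₂)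
    {P : geomPoints W₁} (hP : P ≠ 0) : twistPointsIso hC P ≠ 0 := fun h =>
  hP ((twistPointsIso hC).injective (by rw [h, map_zero]))

/-- `(twistPointsIso hC).symm` preserves non-vanishing. [folklore] -/
theorem twistPointsIso_symm_ne_zero {W₁ W₂ : WeierstrassCurve K} {C : VariableChange K} (hC : C • W₁ = W₂)
    {Q : geomPoints W₂} (hQ : Q ≠ 0) : (twistPointsIso hC).symm Q ≠ 0 := fun h =>
  hQ ((twistPointsIso hC).symm.injective (by rw [h, map_zero]))

/-- Abscissa under the INVERSE change of variables: `x(C⁻¹ Q) = u²·x(Q) + r` for `Q ≠ O`. [cite: SilvermanAEC2009, III.1 Table 3.1] -/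
theorem xco_twistPointsIso_symm {W₁ W₂ : WeierstrassCurve K} {C : VariableChange K} (hC : C • W₁ = W₂)
    (Q : geomPoints W₂) (hQ : Q ≠ 0) :
    xco W₁ ((twistPointsIso hC).symm Q)
      = algebraMap K (AlgebraicClosure K) ((C.u : K) ^ 2) * xco W₂ Q + algebraMap K (AlgebraicClosure K) C.r := by
  have hP : (twistPointsIso hC).symm Q ≠ 0 := twistPointsIso_symm_ne_zero hC hQ
  have h := xco_twistPointsIso hC ((twistPointsIso hC).symm Q) hP
  rw [AddEquiv.apply_symm_apply] at h
  rw [h]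
  have hu : algebraMap K (AlgebraicClosure K) ((C.u : K) ^ 2) * algebraMap K (AlgebraicClosure K) (((C.u⁻¹ : Kˣ) : K) ^ 2) = 1 := by
    rw [← map_mul, ← mul_pow, Units.mul_inv, one_pow, map_one]
  linear_combination (algebraMap K (AlgebraicClosure K) C.r - xco W₁ ((twistPointsIso hC).symm Q)) * hu

/-- Abscissa along an equality of equations: unchanged. [folklore] -/
theorem xco_geomPointsCongr {W₁ W₂ : WeierstrassCurve K} (h : W₁ = W₂) (P : geomPoints W₁) :
    xco W₂ (geomPointsCongr h P) = xco W₁ P := by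
  subst h; rfl

variable [NeZero (2 : K)]

/-- Abscissa under the untwisting `(x, y) ↦ (x/θ², y/θ³)`, `θ² = d`: `x(ι P) = x(P)/d` (also at `P = O`, both sides `0`).
[cite: SilvermanAEC2009, X.5 Cor. 5.4] -/
theorem xco_untwistEquiv (V : WeierstrassCurve K) [V.IsCharNeTwoNF] {d : K} (hd : d ≠ 0) (P : geomPoints (V.quadraticTwist d)) :
    xco V (untwistEquiv V hd P) = (algebraMap K (AlgebraicClosure K) d)⁻¹ * xco (V.quadraticTwist d) P := by
  change ((V.quadraticTwist d).baseChange (AlgebraicClosure K)).toAffine.Point at P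
  rcases P with _ | ⟨x, y, h⟩
  · change xco V (untwistEquiv V hd 0) = _ * xco (V.quadraticTwist d) 0
    rw [map_zero]
    change (0 : AlgebraicClosure K) = _ * 0
    rw [mul_zero]
  · obtain ⟨h', e⟩ := untwistEquiv_some V hd h
    rw [e, ← geomSqrt_sq]
    rfl

/-- **The abscissa along the whole untwisting chain** `e = C₀⁻¹ ∘ ι ∘ (≡) ∘ C⁻¹ : Wd(K̄) → W(K̄)` (`C • W^{(d)} = Wd`, `C₀ • W = V` in
`a₁ = a₃ = 0` form, `W^{(d)} = V^{(d)}`, `ι` the untwisting of `V`): there are `A, B ∈ K`, `A ≠ 0` (namely `A = u₀²u²/d`,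
`B = u₀²r/d + r₀`) with `x(e P) = A·x(P) + B` for every affine `P ∈ Wd(K̄)`. [cite: SilvermanAEC2009, X.5 Cor. 5.4 and III.1 Table 3.1] -/
theorem exists_xco_untwistChain {W Wd V : WeierstrassCurve K} [V.IsCharNeTwoNF] {d : K} (hd : d ≠ 0)
    {C C₀ : VariableChange K} (hWd : C • W.quadraticTwist d = Wd) (hV : C₀ • W = V)
    (hVW : W.quadraticTwist d = V.quadraticTwist d) :
    ∃ A B : K, A ≠ 0 ∧ ∀ P : geomPoints Wd, P ≠ 0 →
      xco W ((twistPointsIso hV).symm (untwistEquiv V hd (geomPointsCongr hVW ((twistPointsIso hWd).symm P))))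
        = algebraMap K (AlgebraicClosure K) A * xco Wd P + algebraMap K (AlgebraicClosure K) B := by
  refine ⟨(C₀.u : K) ^ 2 * (C.u : K) ^ 2 / d, (C₀.u : K) ^ 2 * C.r / d + C₀.r,
    div_ne_zero (mul_ne_zero (pow_ne_zero 2 C₀.u.ne_zero) (pow_ne_zero 2 C.u.ne_zero)) hd, fun P hP => ?_⟩
  have hd' : algebraMap K (AlgebraicClosure K) d ≠ 0 := by
    rw [Ne, map_eq_zero_iff _ (algebraMap K (AlgebraicClosure K)).injective]; exact hd
  -- the intermediate points are affine
  have h1 : (twistPointsIso hWd).symm P ≠ 0 := twistPointsIso_symm_ne_zero hWd hP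
  have h2 : geomPointsCongr hVW ((twistPointsIso hWd).symm P) ≠ 0 := fun h =>
    h1 ((geomPointsCongr hVW).injective (by rw [h, map_zero]))
  have h3 : untwistEquiv V hd (geomPointsCongr hVW ((twistPointsIso hWd).symm P)) ≠ 0 := fun h =>
    h2 ((untwistEquiv V hd).injective (by rw [h, map_zero]))
  rw [xco_twistPointsIso_symm hV _ h3, xco_untwistEquiv V hd, xco_geomPointsCongr hVW, xco_twistPointsIso_symm hWd P hP]
  simp only [map_add, map_mul, map_div₀, map_pow]
  field_simp
  ring

end Abscissa

/-! ## §2 The canonical identification carries a frame datum -/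

section Frame

variable {K : Type u} [Field K] [NeZero (2 : K)]

omit [NeZero (2 : K)] in
/-- **From an affine abscissa relation to a frame datum.** If `ψ : Wd[2] ≃+ W[2]` (any additive bijection) satisfies
`x(ψ t) = A·x(t) + B` (`A, B ∈ K`, `A ≠ 0`) on the nonzero `2`-torsion points, then `ψ T'_j = T_{πj}` for an index map `π` and
`x'_i − x'_j = A⁻¹·(x_{πi} − x_{πj})`. [cite: KlagsbrunMazurRubin2013, Lemma 5.2 (the twisting isomorphism on 2-torsion)] -/
theorem exists_frame_of_xco_affine {W Wd : WeierstrassCurve K} [W.IsElliptic] [Wd.IsElliptic] (h2 : (2 : K) ≠ 0)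
    (ψ : geomTorsion Wd (2 : ℤ) ≃+ geomTorsion W (2 : ℤ)) (A B : K) (hA : A ≠ 0)
    (hx : ∀ t : geomTorsion Wd (2 : ℤ), t ≠ 0 →
      xco W (ψ t : geomPoints W) = algebraMap K (AlgebraicClosure K) A * xco Wd (t : geomPoints Wd)
        + algebraMap K (AlgebraicClosure K) B) :
    ∃ (π : Fin 3 → Fin 3), (∀ j, ψ (T Wd h2 j) = T W h2 (π j)) ∧
      ∀ i j, xT Wd h2 i - xT Wd h2 j
        = algebraMap K (AlgebraicClosure K) A⁻¹ * (xT W h2 (π i) - xT W h2 (π j)) := by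
  have hne : ∀ j, T Wd h2 j ≠ 0 := fun j h0 => coe_T_ne_zero Wd h2 j (by rw [h0, ZeroMemClass.coe_zero])
  have hT : ∀ j, ∃ i, ψ (T Wd h2 j) = T W h2 i := fun j => by
    rcases eq_zero_or_eq_T W h2 (ψ (T Wd h2 j)) with h | ⟨i, hi⟩
    · exact absurd (ψ.injective ((h.trans (map_zero ψ).symm))) (hne j)
    · exact ⟨i, hi⟩
  choose π hπ using hT
  refine ⟨π, hπ, fun i j => ?_⟩
  have hA' : algebraMap K (AlgebraicClosure K) A ≠ 0 := by
    rw [Ne, map_eq_zero_iff _ (algebraMap K (AlgebraicClosure K)).injective]; exact hA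
  have hi := hx (T Wd h2 i) (hne i)
  have hj := hx (T Wd h2 j) (hne j)
  rw [hπ i] at hi
  rw [hπ j] at hj
  change xT W h2 (π i) = _ * xT Wd h2 i + _ at hi
  change xT W h2 (π j) = _ * xT Wd h2 j + _ at hj
  rw [hi, hj, map_inv₀]
  field_simp
  ring

/-- **gk2-p5's canonical identification WITH ITS FRAME DATUM.** For `W/K` (`2 ≠ 0`), `d ≠ 0`, `Wd = C • W^{(d)}`: the statement of
`exists_addEquiv_geomTorsion_two_localSquare_signed` VERBATIM — a `Γ_K`-equivariant `ψ : Wd[2] ≃+ W[2]` and, at every `K`-field `E`, a local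
untwisting `θ_E` commuting with `σ` when `σ ι√d = ι√d`, anti-commuting when `σ ι√d = −ι√d`, the dichotomy, and `ι_*(ψ t) = θ_E(ι_* t)` on
`Wd[2]` — AND the frame datum of the same `ψ`: `∃ π A, (∀ j, ψ T'_j = T_{πj}) ∧ (∀ i j, x'_i − x'_j = A·(x_{πi} − x_{πj}))`
(the untwisting acts on abscissae by `x ↦ (u₀²u²/d)·x + b`, §1). Proof = gk2-p5's, keeping the chain `e` and reading its abscissa.
[cite: MazurRubin2010, Remark 2.4] [cite: SilvermanAEC2009, X.5 Cor. 5.4] [cite: KlagsbrunMazurRubin2013, Lemma 5.2] -/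
theorem exists_addEquiv_geomTorsion_two_localSquare_signed_frame (W : WeierstrassCurve K) [W.IsElliptic] {d : K} (hd : d ≠ 0)
    {Wd : WeierstrassCurve K} [Wd.IsElliptic] {C : VariableChange K} (hWd : C • W.quadraticTwist d = Wd) :
    ∃ (ψ : geomTorsion Wd (2 : ℤ) ≃+ geomTorsion W (2 : ℤ)),
      (∀ (g : absoluteGaloisGroup K) (t : geomTorsion Wd (2 : ℤ)), ψ (g • t) = g • ψ t) ∧
      (∃ (π : Fin 3 → Fin 3) (A : K), (∀ j, ψ (T Wd two_ne_zero j) = T W two_ne_zero (π j)) ∧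
        ∀ i j, xT Wd two_ne_zero i - xT Wd two_ne_zero j
          = algebraMap K (AlgebraicClosure K) A * (xT W two_ne_zero (π i) - xT W two_ne_zero (π j))) ∧
      ∀ (E : Type u) [Field E] [Algebra K E],
        ∃ θ : localPoints Wd E ≃+ localPoints W E,
          (∀ (σ : absoluteGaloisGroup E),
            (show AlgebraicClosure E ≃ₐ[E] AlgebraicClosure E from σ) (closureEmb (K := K) E (geomSqrt d)) =
              closureEmb (K := K) E (geomSqrt d) →
            ∀ Q : localPoints Wd E, θ (σ • Q) = σ • θ Q) ∧
          (∀ (σ : absoluteGaloisGroup E),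
            (show AlgebraicClosure E ≃ₐ[E] AlgebraicClosure E from σ) (closureEmb (K := K) E (geomSqrt d)) =
              -closureEmb (K := K) E (geomSqrt d) →
            ∀ Q : localPoints Wd E, θ (σ • Q) = -(σ • θ Q)) ∧
          (∀ (σ : absoluteGaloisGroup E),
            (show AlgebraicClosure E ≃ₐ[E] AlgebraicClosure E from σ) (closureEmb (K := K) E (geomSqrt d)) =
                closureEmb (K := K) E (geomSqrt d) ∨
              (show AlgebraicClosure E ≃ₐ[E] AlgebraicClosure E from σ) (closureEmb (K := K) E (geomSqrt d)) =
                -closureEmb (K := K) E (geomSqrt d)) ∧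
          ∀ t : geomTorsion Wd (2 : ℤ),
            pointsMap W E (ψ t : geomPoints W) = θ (pointsMap Wd E (t : geomPoints Wd)) := by
  letI : Invertible (2 : K) := invertibleOfNonzero two_ne_zero
  set C₀ : VariableChange K := W.toCharNeTwoNF with hC₀
  set V : WeierstrassCurve K := C₀ • W with hVdef
  haveI : V.IsCharNeTwoNF := by rw [hVdef, hC₀]; infer_instance
  have hV : C₀ • W = V := rfl
  have hVW : W.quadraticTwist d = V.quadraticTwist d := by
    rw [hVdef, quadraticTwist_smul]
    have h1 : (⟨C₀.u, d * C₀.r, 0, 0⟩ : VariableChange K) = 1 := by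
      simp only [hC₀, toCharNeTwoNF, mul_zero]
      rfl
    rw [h1, one_smul]
  set eG : geomPoints Wd ≃+ geomPoints W :=
    (((twistPointsIso hWd).symm.trans (geomPointsCongr hVW)).trans (untwistEquiv V hd)).trans
      (twistPointsIso hV).symm with heG
  have hsign : ∀ (g : absoluteGaloisGroup K) (Q : geomPoints Wd),
      eG (g • Q) = g • eG Q ∨ eG (g • Q) = -(g • eG Q) := fun g Q ↦ by
    rcases map_geomSqrt (absoluteGaloisGroup.toAlgEquiv K g) d with h | h
    · exact Or.inl (untwistChain_smul_of_eq hd hWd hV hVW g h Q)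
    · exact Or.inr (untwistChain_smul_of_eq_neg hd hWd hV hVW g h Q)
  obtain ⟨ψ, hψ, hψe⟩ := exists_addEquiv_geomTorsion_two_of_sign eG hsign
  -- the frame datum of `ψ`, read off the abscissa along the chain
  obtain ⟨A, B, hA, hxco⟩ := exists_xco_untwistChain hd hWd hV hVW
  have hframe : ∃ (π : Fin 3 → Fin 3) (A' : K), (∀ j, ψ (T Wd two_ne_zero j) = T W two_ne_zero (π j)) ∧
      ∀ i j, xT Wd two_ne_zero i - xT Wd two_ne_zero j
        = algebraMap K (AlgebraicClosure K) A' * (xT W two_ne_zero (π i) - xT W two_ne_zero (π j)) := by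
    obtain ⟨π, hπ, hxT⟩ := exists_frame_of_xco_affine two_ne_zero ψ A B hA fun t ht => by
      have h0 : (t : geomPoints Wd) ≠ 0 := fun h0 => ht (Subtype.ext h0)
      rw [hψe t]
      exact hxco (t : geomPoints Wd) h0
    exact ⟨π, A⁻¹, hπ, hxT⟩
  refine ⟨ψ, hψ, hframe, fun E _ _ ↦ ?_⟩
  set L : localPoints (V.quadraticTwist d) E ≃+ localPoints V E :=
    (show localPoints (V.quadraticTwist d) E ≃+ localPoints V E from
      (VariableChange.pointEquiv ((V.quadraticTwist d).baseChange (AlgebraicClosure E))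
          ((untwist hd).map (closureEmb (K := K) E : AlgebraicClosure K →+* AlgebraicClosure E))).trans
        (Affine.Point.congrEquiv (untwist_map_closureEmb_smul V hd E))) with hL
  have hLsome : ∀ (x y : AlgebraicClosure E)
      (h : ((V.quadraticTwist d).baseChange (AlgebraicClosure E)).toAffine.Nonsingular x y),
      ∃ h', L (show localPoints (V.quadraticTwist d) E from .some x y h) =
        (show localPoints V E from .some ((closureEmb (K := K) E (geomSqrt d) ^ 2)⁻¹ * x)
          ((closureEmb (K := K) E (geomSqrt d) ^ 3)⁻¹ * y) h') :=
    fun x y h ↦ localUntwist_some V hd E h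
  set eL : localPoints Wd E ≃+ localPoints W E :=
    (((twistLocalIso E hWd).symm.trans (localPointsCongr E hVW)).trans L).trans (twistLocalIso E hV).symm
    with heL
  refine ⟨eL, fun σ hfix Q ↦ ?_, fun σ hneg Q ↦ ?_, smul_closureEmb_geomSqrt_eq_or_eq_neg E, fun t ↦ ?_⟩
  · simp only [heL, AddEquiv.trans_apply]
    rw [symm_equivariant (twistLocalIso E hWd) (twistLocalIso_smul E hWd) σ Q, localPointsCongr_smul,
      localUntwist_smul_of_fix V E L hLsome σ hfix,
      symm_equivariant (twistLocalIso E hV) (twistLocalIso_smul E hV) σ]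
  · simp only [heL, AddEquiv.trans_apply]
    rw [symm_equivariant (twistLocalIso E hWd) (twistLocalIso_smul E hWd) σ Q, localPointsCongr_smul,
      localUntwist_smul_of_neg V E L hLsome σ hneg, map_neg,
      symm_equivariant (twistLocalIso E hV) (twistLocalIso_smul E hV) σ]
  · rw [hψe t]
    simp only [heG, heL, AddEquiv.trans_apply]
    rw [pointsMap_twistPointsIso_symm hV E, pointsMap_untwistEquiv V hd E L hLsome,
      pointsMap_geomPointsCongr E hVW, pointsMap_twistPointsIso_symm hWd E]

end Frame

end Summit.BirchSwinnertonDyer.BirchSwinnertonDyer.Theorems.GenusKolyTwistLocal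

end
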